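import Mathlib
import Literature.Analysis.FluidPDE.Tao2016AveragedNS.SelfSimilarCascadeBlowup
import HarnessLib

/-!
# The viscous lattice is invariant under `(X, ν, t) ↦ (cX, cν, t/c)`: global regularity depends on the datum and the
  viscosity only through `X₀/ν` — the bridge between «large viscosity at a fixed datum» (route WakeRatchet,
  `largeNuRegular`) and «small datum at a fixed viscosity» (`exists_viscousGlobal_of_smallDatum`) used around the
  survival step (E2) of `stub_eternalFromBlowup` (K2(1) `TaoLadderRungTwoBreak.BlowupRigidityOne`, stmt-NavierStokesRegularity-20206)

MODEL lattice ODEs only (Tao 2016 §4 Lemma 4.1 (4.5), (4.7), (4.11) and the viscous lattice before Thm. 4.2); nothing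
here is a statement about the Navier–Stokes equations; NO item is closed (`--supports stmt-NavierStokesRegularity-20206`).
Route-independent module; general `m`; DEF-FREE.

* `quadTerm_ampTimeScale` — `quadTerm α (t ↦ c·X(ct))_{i,n}(t) = c² · quadTerm α X_{i,n}(ct)` (quadratic, pointwise in time);
* `viscousGlobal_ampScale` — if `X` is a global regular solution of the `ν`-viscous lattice from `X₀`, then
  `(i,n,t) ↦ c·X_{i,n}(ct)` (`c > 0`) is a global regular solution of the `cν`-viscous lattice from `c·X₀`;
* `exists_viscousGlobal_ampScale_iff` — hence `(∃ X, ViscousGlobal ε₀ ν α X₀ X) ↔ (∃ X, ViscousGlobal ε₀ (cν) α (c·X₀) X)`;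
* `exists_viscousGlobal_iff_unitViscosity` — in particular global regularity at viscosity `ν > 0` from `X₀` is global
  regularity at viscosity `1` from `X₀/ν`: the only parameter is `X₀/ν` (together with the table and the scale ratio).

HONEST LABEL: symmetry bookkeeping; no stub, crux or summit is proved; rung 0.
-/

noncomputable section

-- the summit and its single sub-problem share the name (CONVENTIONS §1)
set_option linter.dupNamespace false

open Set Filter Topology

namespace Summit.NavierStokesRegularity.NavierStokesRegularity.Theorems

namespace BlowupRigidityOne

open Literature.Analysis.FluidPDE Literature.Analysis.FluidPDE.TaoCascade

variable {m : ℕ}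

/-- The cascade nonlinearity of the amplitude- and time-scaled family: `quadTerm α (t ↦ c·X(ct))_{i,n}(t) =
c² · quadTerm α X_{i,n}(ct)`. [cite: Tao2016AveragedNS, §4 Lemma 4.1 (4.8)] -/
theorem quadTerm_ampTimeScale (ε₀ c : ℝ) (α : Fin m → Fin m → Fin m → ℤ × ℤ × ℤ → ℝ)
    (X : Fin m → ℤ → ℝ → ℝ) (i : Fin m) (n : ℤ) (t : ℝ) :
    quadTerm ε₀ α (fun j k s => c * X j k (c * s)) i n t = c ^ 2 * quadTerm ε₀ α X i n (c * t) := by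
  simp only [quadTerm, Finset.mul_sum]
  refine Finset.sum_congr rfl fun i₁ _ => Finset.sum_congr rfl fun i₂ _ =>
    Finset.sum_congr rfl fun μ _ => ?_
  ring

/-- **SCALING COVARIANCE OF THE VISCOUS LATTICE.** If `X` is a global regular solution of the NS-scaled `ν`-viscous
lattice from the one-shell datum `X₀` (`ViscousGlobal ε₀ ν α X₀ X`), then for every `c > 0` the family
`(i,n,t) ↦ c·X_{i,n}(ct)` is a global regular solution of the `cν`-viscous lattice from `c·X₀`: the quadratic
nonlinearity and the linear dissipation both pick up the factor `c²` under `(X,t) ↦ (cX, ct)` once `ν ↦ cν`.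
[cite: Tao2016AveragedNS, §4 Lemma 4.1 (4.5), (4.7), (4.11) and the viscous lattice before Thm. 4.2; cell vocabulary (`ViscousGlobal`)] -/
theorem viscousGlobal_ampScale {ε₀ ν c : ℝ} (hc : 0 < c)
    {α : Fin m → Fin m → Fin m → ℤ × ℤ × ℤ → ℝ} {X₀ : Fin m → ℝ} {X : Fin m → ℤ → ℝ → ℝ}
    (h : ViscousGlobal ε₀ ν α X₀ X) :
    ViscousGlobal ε₀ (c * ν) α (fun i => c * X₀ i) (fun i n t => c * X i n (c * t)) where
  contDiffOn i n := contDiffOn_const.mul (contDiffOn_comp_mul_Ici (h.contDiffOn i n) hc)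
  apriori T hT := by
    obtain ⟨M, hM⟩ := h.apriori (c * T) (mul_pos hc hT)
    refine ⟨c * M, fun t ht i n => ?_⟩
    have hct : c * t ∈ Icc 0 (c * T) :=
      ⟨mul_nonneg hc.le ht.1, mul_le_mul_of_nonneg_left ht.2 hc.le⟩
    rw [abs_mul, abs_of_pos hc]
    calc (1 + (1 + ε₀) ^ ((10 : ℝ) * n)) * (c * |X i n (c * t)|)
        = c * ((1 + (1 + ε₀) ^ ((10 : ℝ) * n)) * |X i n (c * t)|) := by ring
      _ ≤ c * M := mul_le_mul_of_nonneg_left (hM (c * t) hct i n) hc.le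
  init i n := by
    rw [mul_zero, h.init i n]
    split_ifs <;> simp
  motion i n t ht := by
    -- derivative of `s ↦ X (c s)` within `[0,∞)`, then the constant multiple
    have hg : ContDiffOn ℝ 1 (fun s => X i n (c * s)) (Ici 0) := contDiffOn_comp_mul_Ici (h.contDiffOn i n) hc
    have hDg : derivWithin (fun s => X i n (c * s)) (Ici 0) t = c * derivWithin (X i n) (Ici 0) (c * t) :=
      derivWithin_comp_mul_Ici (h.contDiffOn i n) hc ht
    have hd : HasDerivWithinAt (fun s => X i n (c * s)) (derivWithin (fun s => X i n (c * s)) (Ici 0) t)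
        (Ici 0) t := ((hg.differentiableOn one_ne_zero) t (mem_Ici.2 ht)).hasDerivWithinAt
    have hD : derivWithin (fun s => c * X i n (c * s)) (Ici 0) t
        = c * derivWithin (fun s => X i n (c * s)) (Ici 0) t :=
      (hd.const_mul c).derivWithin (uniqueDiffOn_Ici 0 t (mem_Ici.2 ht))
    rw [hD, hDg, h.motion i n (c * t) (mul_nonneg hc.le ht), quadTerm_ampTimeScale]
    ring
  noLow i n t hn ht := by rw [h.noLow i n (c * t) hn (mul_nonneg hc.le ht), mul_zero]

/-- **Global regularity is a function of `X₀/ν`**: `(∃ X, ViscousGlobal ε₀ ν α X₀ X) ↔ (∃ X, ViscousGlobal ε₀ (cν) α (c·X₀) X)`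
for every `c > 0`. [cite: Tao2016AveragedNS, §4 (viscous lattice before Thm. 4.2); cell vocabulary (`ViscousGlobal`)] -/
theorem exists_viscousGlobal_ampScale_iff {ε₀ ν c : ℝ} (hc : 0 < c)
    {α : Fin m → Fin m → Fin m → ℤ × ℤ × ℤ → ℝ} {X₀ : Fin m → ℝ} :
    (∃ X : Fin m → ℤ → ℝ → ℝ, ViscousGlobal ε₀ ν α X₀ X) ↔
      ∃ X : Fin m → ℤ → ℝ → ℝ, ViscousGlobal ε₀ (c * ν) α (fun i => c * X₀ i) X := by
  constructor
  · rintro ⟨X, hX⟩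
    exact ⟨_, viscousGlobal_ampScale hc hX⟩
  · rintro ⟨Y, hY⟩
    have h := viscousGlobal_ampScale (inv_pos.2 hc) hY
    have hν : c⁻¹ * (c * ν) = ν := by rw [← mul_assoc, inv_mul_cancel₀ hc.ne', one_mul]
    have hX₀ : (fun i => c⁻¹ * ((fun i => c * X₀ i) i)) = X₀ := by
      funext i
      rw [← mul_assoc, inv_mul_cancel₀ hc.ne', one_mul]
    rw [hν, hX₀] at h
    exact ⟨_, h⟩

/-- **Unit viscosity suffices**: for `ν > 0`, the `ν`-viscous lattice is globally regular from `X₀` iff the `1`-viscous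
lattice is globally regular from `X₀/ν`. So «large `ν` at a fixed datum» (route WakeRatchet's `largeNuRegular`) and
«small datum at a fixed `ν`» (`exists_viscousGlobal_of_smallDatum`) are one statement.
[cite: Tao2016AveragedNS, §4 (viscous lattice before Thm. 4.2); cell vocabulary (`ViscousGlobal`)] -/
theorem exists_viscousGlobal_iff_unitViscosity {ε₀ ν : ℝ} (hν : 0 < ν)
    {α : Fin m → Fin m → Fin m → ℤ × ℤ × ℤ → ℝ} {X₀ : Fin m → ℝ} :
    (∃ X : Fin m → ℤ → ℝ → ℝ, ViscousGlobal ε₀ ν α X₀ X) ↔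
      ∃ X : Fin m → ℤ → ℝ → ℝ, ViscousGlobal ε₀ 1 α (fun i => ν⁻¹ * X₀ i) X := by
  have h := exists_viscousGlobal_ampScale_iff (ε₀ := ε₀) (ν := ν) (α := α) (X₀ := X₀) (inv_pos.2 hν)
  rwa [inv_mul_cancel₀ hν.ne'] at h

end BlowupRigidityOne

end Summit.NavierStokesRegularity.NavierStokesRegularity.Theorems

end
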